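import Summits.CriticalPhenomena.CardyFormulaZ2.Theses.CardySegmentWeakRSW
import Summits.CriticalPhenomena.CardyFormulaZ2.Theorems.CardySelfDualSegmentSmirnovBasePoint
import Literature.Probability.RandomPlanarGeometry.ConformalRectangleProofs
import Literature.Probability.RandomPlanarGeometry.SLESixCrossingNondegenerate
import Literature.Barriers.CriticalPhenomena.EmbeddingModulusUniquenessProofs
import HarnessLib

/-!
# Route `CardySegmentWeakRSW`, crux `WeakBoxCrossing` (stmt-CriticalPhenomena-18422): Cardy-good parameters cross weakly

Weak box crossing at a parameter `t` — some `c > 0` such that at arbitrarily small meshes the crude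
bottom-to-top `M_t`-crossing probability of the box `Q = (0,2) × (0,1)` is `≤ 1 - c` — is NECESSARY for
`t` to be Cardy-good:

* `weakBoxCrossingAt_of_cardyMod` — if `M_t` has Cardy limits after the shear `φ_α` (`CardyMod t α`,
  `im α > 0`), then `P_t(Q, δ) → F(η) ∈ (0,1)` as `δ → 0⁺` (`η` the cross-ratio of the sheared partner
  `φ_α(Q)`, uniformizing data by `MarkedDomain.exists_isUniformizing_holds`, `cardyFunction_mem_Ioo`), so
  `P_t(Q, δ) ≤ 1 - (1 - F(η))/2` at all small meshes;
* `weakBoxCrossing_at_zero` — the `t = 0` instance of the crux HOLDS (Smirnov's theorem transported to the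
  corner model `M_0`: `tendsto_cornerCrossingProb_zero`, the route's base point);
* `weakBoxCrossing_of_segmentUniversality` — if EVERY `M_t`, `t ∈ [0,1]`, is Cardy-good (the conclusion
  `G = [0,1]` of the continuity method of routes `CardySelfDualSegment` / `CardySegmentWeakRSW`), then the crux
  `WeakBoxCrossing` holds: the crux is implied by the segment-universality statement it serves, i.e. it
  cannot be refuted without refuting universality along the corner segment.

Together with `weakBoxCrossing_at_one` (`CardySegmentWeakRSWWeakBoxCrossingPointwise.lean`) both endpoints
of the segment satisfy the crux; its content is the interior `t ∈ (0,1)`.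

prover-fwd2-land-1-0, 2026-08-18. [folklore]
-/

noncomputable section

open Set Filter Metric MeasureTheory Complex
open scoped Topology
open Literature.Probability.RandomPlanarGeometry Literature.Probability.Percolation
open Literature.Probability.LatticeModels Literature.Barriers.CriticalPhenomena
open UpperHalfPlane (upperHalfPlaneSet)

namespace Summit.CriticalPhenomena.CardyFormulaZ2.Theorems

/-- **Cardy-good ⇒ weak box crossing.** If `M_t` has Cardy limits after the shear `φ_α` (`im α > 0`),
then for some `c > 0` the crude bottom-to-top `M_t`-crossing probability of `(0,2) × (0,1)` is `≤ 1 - c`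
at arbitrarily small meshes: the limit is a Cardy value `F(η) < 1` of the sheared box. [folklore] -/
theorem weakBoxCrossingAt_of_cardyMod (t : unitInterval) (α : ℂ) (hα : 0 < α.im)
    (hCardy : ∀ (R R' : ConformalRectangle) (φ : ConformalEquiv upperHalfPlaneSet R.carrier)
      (x : Fin 4 → ℝ), R.carrier = moduliShear α '' R'.carrier →
      (∀ i, R.pt i = moduliShear α (R'.pt i)) → R.IsUniformizing φ x →
      Tendsto (cornerCrossingProb t R') (𝓝[>] 0)
        (𝓝 (Literature.Probability.RandomPlanarGeometry.cardyFunction (crossRatio x)))) :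
    ∃ c > 0, ∀ δ₀ : ℝ, 0 < δ₀ → ∃ δ : ℝ, 0 < δ ∧ δ < δ₀ ∧
      cornerCrossingProb t (rectQuad 0 2 0 1 two_pos one_pos) δ ≤ 1 - c := by
  set Q : ConformalRectangle := rectQuad 0 2 0 1 two_pos one_pos
  obtain ⟨φ, x, hφ⟩ := MarkedDomain.exists_isUniformizing_holds (Q.map (shearHomeomorph α hα.ne'))
  have hL := Literature.Probability.RandomPlanarGeometry.cardyFunction_mem_Ioo
    (ConformalRectangle.crossRatio_mem_Ioo_of_isUniformizing hφ)
  set L := Literature.Probability.RandomPlanarGeometry.cardyFunction (crossRatio x)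
  have hT : Tendsto (cornerCrossingProb t Q) (𝓝[>] 0) (𝓝 L) :=
    hCardy _ Q φ x (by rw [MarkedDomain.carrier_map, coe_shearHomeomorph])
      (fun i => by rw [MarkedDomain.pt_map, coe_shearHomeomorph]) hφ
  refine ⟨(1 - L) / 2, by linarith [hL.2], fun δ₀ hδ₀ => ?_⟩
  have h1 : ∀ᶠ δ in 𝓝[>] (0 : ℝ), cornerCrossingProb t Q δ < L + (1 - L) / 2 :=
    hT (Iio_mem_nhds (by linarith [hL.2]))
  have h2 : ∀ᶠ δ in 𝓝[>] (0 : ℝ), δ < δ₀ := nhdsWithin_le_nhds (Iio_mem_nhds hδ₀)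
  have h3 : ∀ᶠ δ in 𝓝[>] (0 : ℝ), 0 < δ := self_mem_nhdsWithin
  obtain ⟨δ, hP, hδ₀', hδ⟩ := (h1.and (h2.and h3)).exists
  exact ⟨δ, hδ, hδ₀', by linarith⟩

/-- **Weak box crossing holds at the base point `t = 0`.** `M_0` has Cardy limits after the shear
`φ_ζ`, `ζ = e^{iπ/3}` (`tendsto_cornerCrossingProb_zero`: Smirnov's theorem transported to the corner
model), and `im ζ = sin(π/3) > 0`. [folklore] -/
theorem weakBoxCrossing_at_zero :
    ∃ c > 0, ∀ δ₀ : ℝ, 0 < δ₀ → ∃ δ : ℝ, 0 < δ ∧ δ < δ₀ ∧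
      cornerCrossingProb 0 (rectQuad 0 2 0 1 two_pos one_pos) δ ≤ 1 - c := by
  have hz : 0 < triZeta.im := by
    unfold triZeta
    rw [Complex.exp_im]
    have hre : ((Real.pi : ℂ) * Complex.I / 3).re = 0 := by simp
    have him : ((Real.pi : ℂ) * Complex.I / 3).im = Real.pi / 3 := by simp
    rw [hre, him, Real.exp_zero, one_mul]
    exact Real.sin_pos_of_pos_of_lt_pi (by positivity) (by linarith [Real.pi_pos])
  exact weakBoxCrossingAt_of_cardyMod 0 triZeta hz
    fun R R' φ x hcar hpt hφ =>
      Summit.CriticalPhenomena.CardyFormulaZ2.Cruxes.SmirnovBasePoint.ShearedSandwich.tendsto_cornerCrossingProb_zero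
        R R' φ x hcar hpt hφ

/-- **Segment universality ⇒ `WeakBoxCrossing`.** If every corner model `M_t`, `t ∈ [0,1]`, has Cardy
limits after some shear `φ_α`, `im α > 0` (the conclusion `G = [0,1]` of the continuity method), then the
crux `WeakBoxCrossing` holds (`weakBoxCrossingAt_of_cardyMod` at every `t`; the route's `P t R δ` is
`cornerCrossingProb t R δ` by `rfl`). [folklore] -/
theorem weakBoxCrossing_of_segmentUniversality
    (hG : ∀ t : unitInterval, ∃ α : ℂ, 0 < α.im ∧
      ∀ (R R' : ConformalRectangle) (φ : ConformalEquiv upperHalfPlaneSet R.carrier)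
        (x : Fin 4 → ℝ), R.carrier = moduliShear α '' R'.carrier →
        (∀ i, R.pt i = moduliShear α (R'.pt i)) → R.IsUniformizing φ x →
        Tendsto (cornerCrossingProb t R') (𝓝[>] 0)
          (𝓝 (Literature.Probability.RandomPlanarGeometry.cardyFunction (crossRatio x)))) :
    Summit.CriticalPhenomena.CardyFormulaZ2.Theses.CardySegmentWeakRSW.WeakBoxCrossing := by
  intro t
  obtain ⟨α, hα, hCardy⟩ := hG t
  exact weakBoxCrossingAt_of_cardyMod t α hα hCardy

end Summit.CriticalPhenomena.CardyFormulaZ2.Theorems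

end
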